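import Summits.Ventures.PercRepro.ProfilePointedCircuitClassesTwelveQuadB

/-!
# PercRepro — THE TWELVE-POINT STATEMENT `InOutBottomTwelve` WHEN EVERY CO-RANK-2 QUADRUPLE CONTAINS A SERIES PAIR
WITH CO-INDEPENDENT COMPLEMENT, I: THE WEIGHTS `(16, 4)`, THE UNITS' SIDE, THE DEMANDS WITH `≠ 4` NON-COLOOPS
(p5, gen 43; `proofs/P5-GM1.md` §65(i))

The quad regime (TwelveQuadA/B) excluded the demands with exactly four non-coloops.  Re-weighting the §64 charging
admits the most common of them: `pwt60bb` = `60 / p(U)` on a disjoint pair, `16` for a `(2,0)`-unit, `4` on a clean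
pair of a `(2,0)`-unit with a demand of AT MOST FOUR non-coloops (`deficient4`), `0` otherwise.  A `(2,0)`-unit now
receives `2·16 + 6·4 = 56 ≤ 60` with the trivial bound (one clean demand per point of the unit), so no refined unit
bound is needed (`sum_pwt60bb_le_sixty`); every disjoint pair still weighs `≥ 12`; a demand with `≥ 5` non-coloops
sends `≥ 60`; a demand with three non-coloops (`B = K ⊔ P`) sends `≥ 60` through its three disjoint units of common
weight `wt ∈ {16, 12, 15, 20, 30, 60}` and, when `3·wt < 60`, one (`wt = 16`) or two (`wt ∈ {15, 12}`) substitution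
points' clean units `K + p + w` of weight `4` (`sixty_le_sum_pwt60bb_of_deficient`).  The demands with exactly four
non-coloops — `B = K ⊔ D`, `D` a parallel pair with two further non-parallel points — and the transfer are part II
(ProfilePointedCircuitClassesTwelveQuadD).
-/

open scoped Matroid

namespace PercRepro.Cogirth

open Finset ThmH Skew Shadow Profile

variable {α : Type} [DecidableEq α] {M : Matroid α} [M.Finite]

section TwelveQuadC

/-- Demands with at most FOUR non-coloops in `B = E ∖ W` (`κ(B) ≥ 3`: the deficient demands of §63). -/
abbrev deficient4 (M : Matroid α) [M.Finite] (W : Finset α) : Prop := (nonco M W).card ≤ 4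

/-- The integer weight `×60` of the pair (demand `W`, unit `U`), second version: `60 / p(U)` on disjoint pairs
(`16` for `(2,0)`-units), `4` on clean pairs of `(2,0)`-units with demands of at most four non-coloops, `0` otherwise. -/
noncomputable def pwt60b (M : Matroid α) [M.Finite] (S W U : Finset α) : ℕ :=
  if W ∩ U = ∅ then (if type20 M S U then 16 else 60 / pU M S U)
  else (if (W ∩ U).card = 1 ∧ (gr M \ W) \ U = circ5 M (gr M \ U) ∧ type20 M S U ∧ deficient4 M W then 4
    else 0)

/-- **THE UNITS' SIDE `×60`, second weights**: every unit receives at most `60` — `p(U)·(60 / p(U)) ≤ 60` from the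
disjoint demands (or `2·16 = 32` for a `(2,0)`-unit), and at most one clean demand per point of `U` (each `4`, only
for `(2,0)`-units): `32 + 24 ≤ 60`. -/
theorem sum_pwt60b_le_sixty (hn : (gr M).card = 12) (hR : rk M (gr M) = 5) {S : Finset α} (hS : S ⊆ gr M)
    {U : Finset α} (hU : U ∈ punit M S) : ∑ W ∈ pdem M S, pwt60b M S W U ≤ 60 := by
  rw [← sum_filter_add_sum_filter_not (pdem M S) (fun W => W ∩ U = ∅)]
  have hU6 : U.card = 6 := (mem_punit.1 hU).2.1
  -- the disjoint demands
  have h1 : ∑ W ∈ (pdem M S).filter (fun W => W ∩ U = ∅), pwt60b M S W U =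
      (if type20 M S U then 32 else pU M S U * (60 / pU M S U)) := by
    have e : ∀ W ∈ (pdem M S).filter (fun W => W ∩ U = ∅),
        pwt60b M S W U = (if type20 M S U then 16 else 60 / pU M S U) := by
      intro W hW
      unfold pwt60b
      rw [if_pos (mem_filter.1 hW).2]
    rw [sum_congr rfl e, sum_const, card_filter_pdem_inter_eq hn hR hS hU, smul_eq_mul]
    split_ifs with h20
    · rw [pU_eq_two_of_type20 h20]
    · rfl
  -- the clean demands
  have h2 : ∑ W ∈ (pdem M S).filter (fun W => ¬ W ∩ U = ∅), pwt60b M S W U ≤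
      (if type20 M S U then 24 else 0) := by
    have e : ∀ W ∈ (pdem M S).filter (fun W => ¬ W ∩ U = ∅), pwt60b M S W U =
        (if (W ∩ U).card = 1 ∧ (gr M \ W) \ U = circ5 M (gr M \ U) ∧ type20 M S U ∧ deficient4 M W then 4
          else 0) := by
      intro W hW
      unfold pwt60b
      rw [if_neg (mem_filter.1 hW).2]
    rw [sum_congr rfl e, ← sum_filter, sum_const, smul_eq_mul]
    split_ifs with h20
    · -- at most one clean demand per point of `U`: `W ↦ W ∩ U` is injective
      have hcard : (((pdem M S).filter (fun W => ¬ W ∩ U = ∅)).filter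
            (fun W => (W ∩ U).card = 1 ∧ (gr M \ W) \ U = circ5 M (gr M \ U) ∧ type20 M S U ∧
              deficient4 M W)).card ≤ 6 := by
        calc _ ≤ (U.powersetCard 1).card := by
              apply card_le_card_of_injOn (fun W => W ∩ U)
              · intro W hW
                rw [mem_coe, mem_filter] at hW
                rw [mem_coe, mem_powersetCard]
                exact ⟨inter_subset_right, hW.2.1⟩
              · intro W₁ hW₁ W₂ hW₂ h
                rw [mem_coe, mem_filter, mem_filter] at hW₁ hW₂
                simp only at h
                have key : ∀ W : Finset α, W ∈ pdem M S → (gr M \ W) \ U = circ5 M (gr M \ U) →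
                    W = ((gr M \ U) \ circ5 M (gr M \ U)) ∪ (W ∩ U) := by
                  intro W hW hcl
                  have hWg : W ⊆ gr M := (mem_pdem.1 hW).1
                  have hsub : W \ U ⊆ gr M \ U := sdiff_subset_sdiff hWg (Subset.refl _)
                  have e1 : (gr M \ U) \ (W \ U) = (gr M \ W) \ U := by
                    ext a
                    simp only [mem_sdiff, not_and, not_not]
                    tauto
                  have e2 : W \ U = (gr M \ U) \ circ5 M (gr M \ U) := by
                    rw [← hcl, ← e1, Finset.sdiff_sdiff_eq_self hsub]
                  rw [← e2, sdiff_union_inter]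
                rw [key W₁ hW₁.1.1 hW₁.2.2.1, key W₂ hW₂.1.1 hW₂.2.2.1, h]
          _ = 6 := by rw [card_powersetCard, Nat.choose_one_right, hU6]
      omega
    · -- no `(2,0)`-unit: the clean condition is never met
      have : (((pdem M S).filter (fun W => ¬ W ∩ U = ∅)).filter
            (fun W => (W ∩ U).card = 1 ∧ (gr M \ W) \ U = circ5 M (gr M \ U) ∧ type20 M S U ∧
              deficient4 M W)).card = 0 := by
        rw [card_eq_zero, filter_eq_empty_iff]
        intro W _ hW
        exact h20 hW.2.2.1
      rw [this]
  have h3 : (if type20 M S U then 32 else pU M S U * (60 / pU M S U)) +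
      (if type20 M S U then 24 else 0) ≤ 60 := by
    split_ifs
    · norm_num
    · have := Nat.mul_div_le 60 (pU M S U)
      omega
  omega

/-- Every disjoint pair carries weight at least `12` (`p(U) ∈ [1, 5]` for a singleton `S`, or the `(2,0)` weight
`16`). -/
theorem twelve_le_pwt60b_of_inter_eq_empty (hn : (gr M).card = 12) (hR : rk M (gr M) = 5) {S : Finset α}
    (hS : S ⊆ gr M) (hS1 : S.card = 1) {W U : Finset α} (hW : W ∈ pdem M S) (hU : U ∈ punit M S)
    (hWU : W ∩ U = ∅) : 12 ≤ pwt60b M S W U := by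
  unfold pwt60b
  rw [if_pos hWU]
  split_ifs with h20
  · norm_num
  · have h5 := pU_le_five hn hS hS1 hU
    have h1 : 1 ≤ pU M S U := by
      rw [← card_filter_pdem_inter_eq hn hR hS hU]
      exact card_pos.2 ⟨W, mem_filter.2 ⟨hW, hWU⟩⟩
    interval_cases (pU M S U) <;> norm_num

/-- **A DEMAND WITH AT LEAST FIVE NON-COLOOPS SENDS AT LEAST `60`**: five disjoint units of weight `≥ 12`. -/
theorem sixty_le_sum_pwt60b_of_five_le (hn : (gr M).card = 12) (hR : rk M (gr M) = 5) {S : Finset α}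
    (hS : S ⊆ gr M) (hS1 : S.card = 1) {W : Finset α} (hW : W ∈ pdem M S) (h5 : 5 ≤ (nonco M W).card) :
    60 ≤ ∑ U ∈ punit M S, pwt60b M S W U := by
  calc 60 ≤ 12 * ((punit M S).filter (fun U => W ∩ U = ∅)).card := by
        rw [card_filter_punit_inter_eq hn hR hW]; omega
    _ ≤ ∑ U ∈ (punit M S).filter (fun U => W ∩ U = ∅), pwt60b M S W U := by
        rw [mul_comm, ← smul_eq_mul]
        apply card_nsmul_le_sum
        intro U hU
        rw [mem_filter] at hU
        exact twelve_le_pwt60b_of_inter_eq_empty hn hR hS hS1 hW hU.1 hU.2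
    _ ≤ ∑ U ∈ punit M S, pwt60b M S W U := sum_le_sum_of_subset (filter_subset _ _)

/-- The second weight `×60` of the disjoint unit `B − p`, `p ∈ nonco(W)`: `16` for a `(2,0)`-unit
(`cw(W, p) = {w}` with `w ∉ S`), else `60 / (#(cw(W, p) ∖ S) + 1)`. -/
theorem pwt60b_erase_eq {S W : Finset α} (hW : W ∈ pdem M S) {p : α} (hp : p ∈ nonco M W) :
    pwt60b M S W ((gr M \ W).erase p) =
      (if (cw M W p).card = 1 ∧ cw M W p ∩ S = ∅ then 16 else 60 / ((cw M W p \ S).card + 1)) := by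
  obtain ⟨hWg, hW5, hSW, hWr, _⟩ := mem_pdem.1 hW
  have hpB : p ∈ gr M \ W := by unfold nonco at hp; exact (mem_filter.1 hp).1
  have hpW : p ∉ W := (mem_sdiff.1 hpB).2
  have hpS : p ∉ S := fun h => hpW (hSW h)
  have hpcw : p ∉ cw M W p := fun h => hpW (filter_subset _ _ h)
  have hWU : W ∩ (gr M \ W).erase p = ∅ :=
    disjoint_iff_inter_eq_empty.1 (disjoint_of_subset_right (erase_subset _ _) sdiff_disjoint.symm)
  unfold pwt60b
  rw [if_pos hWU]
  have hZ : gr M \ (gr M \ W).erase p = insert p W := sdiff_erase_sdiff_eq_insert hWg hpB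
  have hc : circ5 M (gr M \ (gr M \ W).erase p) = insert p (cw M W p) := by
    rw [hZ, circ5_insert_eq hWr hpW]
  have ht : type20 M S ((gr M \ W).erase p) ↔ ((cw M W p).card = 1 ∧ cw M W p ∩ S = ∅) := by
    unfold type20
    rw [hc, card_insert_of_notMem hpcw]
    constructor
    · rintro ⟨h1, h2⟩
      refine ⟨by omega, ?_⟩
      rw [← subset_empty, ← h2]
      exact inter_subset_inter (subset_insert _ _) (Subset.refl _)
    · rintro ⟨h1, h2⟩
      refine ⟨by omega, ?_⟩
      rw [insert_inter_of_notMem hpS, h2]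
  have hpU : pU M S ((gr M \ W).erase p) = (cw M W p \ S).card + 1 := by
    unfold pU
    rw [hc, insert_sdiff_of_notMem _ hpS, card_insert_of_notMem (fun h => hpcw (mem_sdiff.1 h).1)]
  by_cases h20 : (cw M W p).card = 1 ∧ cw M W p ∩ S = ∅
  · rw [if_pos (ht.2 h20), if_pos h20]
  · rw [if_neg (fun h => h20 (ht.1 h)), if_neg h20, hpU]

/-- A pair of weight `1` in the `×12` scale has second weight `4` (it is a clean pair of a demand with three
non-coloops, hence of at most four). -/
theorem pwt60b_eq_four_of_pwt_eq_one (hn : (gr M).card = 12) {S W U : Finset α} (hU : U ∈ punit M S)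
    (h : pwt M S W U = 1) : pwt60b M S W U = 4 := by
  have h6 := pU_le_six hn hU
  unfold pwt at h
  unfold pwt60b
  by_cases hWU : W ∩ U = ∅
  · rw [if_pos hWU] at h
    rw [if_pos hWU]
    by_cases h20 : type20 M S U
    · rw [if_pos h20] at h
      omega
    · rw [if_neg h20] at h
      exfalso
      have hp1 : 1 ≤ pU M S U := by
        by_contra h0
        have : pU M S U = 0 := by omega
        rw [this] at h
        norm_num at h
      interval_cases (pU M S U) <;> norm_num at h
  · rw [if_neg hWU] at h
    rw [if_neg hWU]
    by_cases hcl : (W ∩ U).card = 1 ∧ (gr M \ W) \ U = circ5 M (gr M \ U) ∧ type20 M S U ∧ deficient M W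
    · have hcl4 : (W ∩ U).card = 1 ∧ (gr M \ W) \ U = circ5 M (gr M \ U) ∧ type20 M S U ∧ deficient4 M W :=
        ⟨hcl.1, hcl.2.1, hcl.2.2.1, by unfold deficient4; unfold deficient at hcl; omega⟩
      rw [if_pos hcl4]
    · rw [if_neg hcl] at h
      omega

end TwelveQuadC

end PercRepro.Cogirth
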